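import Summits.ResolutionOfSingularities.ResolutionOfSingularities.Theorems.FrobeniusClosingPatchingRelPerfectConeDepthLadderClimb
import Summits.ResolutionOfSingularities.ResolutionOfSingularities.Theorems.FrobeniusClosingPatchingRelPerfectConeDepthVertexFibre
import HarnessLib

/-!
# Crux `PatchingRelPerfect` (stmt-ResolutionOfSingularities-16161), chain W5.2 — RUNG «r-cone-ℓ» BY NAME: the quadric cone at
# EVERY exceptional depth, `(x₀x₁ + x₂²) + 𝔪^{ℓ+2} ∈ 𝒞`, kernel-checked

[OURS · L1 W5.2 · rung] Replaces the role of NO printed item; NOT a statement of the manuscript under review; fact-free, EVERY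
characteristic, EVERY residue field, no completeness.  AI-written (AI review is weaker than expert review).

`S` regular local with regular system of parameters `x₀, …, x₃`, `q = x₀x₁ + x₂²` (the quadric cone, vertex the closed point; the
minimal `(ℓ,2)`-deficient family of the kernel sentence — exceptional depth `ℓ`, order `2 < ℓ` for `ℓ ≥ 3`, singular initial
form, NOT covered by the degree-`ℓ` pure rung R4ˢ-pure nor by the depth-two instance `…ConeDepthTwo` (stub-3, `ℓ = 2`)).
For EVERY `ℓ` and every blowing up `T = Bl_I Spec S` of `I = (q) + 𝔪^{ℓ+2}`, `T` carries a non-zero ideal sheaf cosupported in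
the closed fibre whose blowing up is regular (`coreRung_cone_sup_pow`; `…_of_ringKrullDim`; and in the registered core's binder
shape `atomDimFourBlowupAt_cone_sup_pow`).

MECHANISM — the vertex-blowup ladder (`…ConeDepthLadderEnd/Step/Climb`): blow up the closed point; on `X₁ = Bl_𝔪 Spec S`,
`I𝒪 = 𝓘_{E₁}²(𝓗₁ ⊔ 𝓘_{E₁}^ℓ)` with `𝓗₁` the strict transform of the cone, again a quadric cone at ONE closed point `z₁ ∈ E₁`
(the new vertex) and simple normal crossings with `E₁` elsewhere (THE VERTEX FIBRE THEOREM `ConeDepth.vertex_fibre`,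
`…ConeDepthVertexFibre`, from the chart algebra `…ConeDepthChartAlgebra/ChartKill/ConeCharts/ConeChartsOff/ConeChartThree` and
the stalk dictionary `…ConeDepthFibreCharts`); blowing up the successive vertices lowers the vertex exponent by `2` each time
(`LadderState.step`), and when it reaches `0` the residual ideal is a sum of two monomials in a boundary with simple normal
crossings along its cosupport, principalised by the tree's pointwise pair game (`DepthTargets.pointwisePairGame_holds`) and
contracted (`atomConclusion_of_tower`).  All centres are closed points or regular strata over the closed point.

## References
* J. Kollár, *Lectures on Resolution of Singularities* (2007), 3.61 (resolving the quadric cone / pinch points by blowing up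
  points), (3.111) Step 3. [Kollar2007]
* Q. Liu, *Algebraic Geometry and Arithmetic Curves* (2002), Thm. 8.1.19 (a). [Liu2002]
* The Stacks Project, Tags 080A, 080B, 0804, 02ND. [StacksProject]
* H. Matsumura, *Commutative Ring Theory* (1986), Thms. 14.2, 16.2. [Matsumura1987]
-/

set_option linter.dupNamespace false

noncomputable section

open CategoryTheory CategoryTheory.Limits AlgebraicGeometry TopologicalSpace IsLocalRing
open Literature.AlgebraicGeometry.Resolution
open Scheme.IdealSheafData

namespace Summit.ResolutionOfSingularities.ResolutionOfSingularities.Theorems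

universe u

namespace ConeDepth

/-! ## The rung by name -/

section Rung

variable {S : Type u} [CommRing S] [IsRegularLocalRing S]
  (x : Fin 4 → S) (hx : Ideal.span (Set.range x) = maximalIdeal S) (hdim : ringKrullDim S = (4 : ℕ)) (ℓ : ℕ)

include hdim in
/-- `dim S = 4` ⟹ `μ(𝔪) = 4` for a regular local ring. [folklore] -/
theorem spanFinrank_maximalIdeal_eq_four : (maximalIdeal S).spanFinrank = 4 := by
  have h := IsRegularLocalRing.spanFinrank_maximalIdeal (R := S)
  rw [hdim] at h
  exact_mod_cast h

include hx hdim in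
/-- **RUNG «r-cone-ℓ», UNCONDITIONAL PACKAGE** for `S` regular local of dimension `4`, `x` spanning `𝔪`, `q = x₀x₁ + x₂²` and EVERY
`ℓ`: (1) `(q) + 𝔪^{ℓ+2} ∈ 𝒞` — an `𝔪`-primary companion `Q ⊇ 𝔪^m` with a REGULAR blowing up of `Spec S` along `I · Q`;
(2) the blow-up-form core conclusion for every `T = Bl_I Spec S`, `I = (q) + 𝔪^{ℓ+2}`; (3) the same for the sup-reduced member
`I' = (x₀^{ℓ+2}, …, x₃^{ℓ+2}, q)`.  The `…_of` theorems of `…ConeDepthLadderClimb` with their hypothesis `hVF` DISCHARGED by the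
vertex fibre theorem `ConeDepth.vertex_fibre`.  Every characteristic, every residue field, no completeness, fact-free.
[cite: Kollar2007, 3.61 and (3.111) Step 3] [cite: StacksProject, Tag 080A] -/
theorem coneRung_of_ringKrullDim :
    (∃ (Q : Ideal S) (m : ℕ), IsLocalRing.maximalIdeal S ^ m ≤ Q ∧
      ∃ (B' : Scheme.{u}) (b : B' ⟶ Spec (.of S)),
        IsBlowup b (affineBlowup.idealSheaf ((Ideal.span {x 0 * x 1 + x 2 ^ 2} ⊔ maximalIdeal S ^ (ℓ + 2)) * Q)) ∧
        Scheme.IsRegular B') ∧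
    (∀ (T : Scheme.{u}) (f : T ⟶ Spec (.of S)),
      IsBlowup f (affineBlowup.idealSheaf (Ideal.span {x 0 * x 1 + x 2 ^ 2} ⊔ maximalIdeal S ^ (ℓ + 2))) →
      ∃ (J : T.IdealSheafData) (T' : Scheme.{u}) (π : T' ⟶ T), J ≠ ⊥ ∧
        (∀ t : T, t ∈ J.support → f.base t = IsLocalRing.closedPoint S) ∧
        IsBlowup π J ∧ Scheme.IsRegular T') ∧
    (∀ (T : Scheme.{u}) (f : T ⟶ Spec (.of S)),
      IsBlowup f (affineBlowup.idealSheaf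
        (Ideal.span (Set.range (fun i : Fin 4 => x i ^ (ℓ + 2)) ∪ {x 0 * x 1 + x 2 ^ 2}))) →
      ∃ (J : T.IdealSheafData) (T' : Scheme.{u}) (π : T' ⟶ T), J ≠ ⊥ ∧
        (∀ t : T, t ∈ J.support → f.base t = IsLocalRing.closedPoint S) ∧
        IsBlowup π J ∧ Scheme.IsRegular T') := by
  have hd : (maximalIdeal S).spanFinrank = 4 := spanFinrank_maximalIdeal_eq_four hdim
  refine ⟨?_, ?_, ?_⟩
  · exact companion_cone_sup_pow_of (fun hσ z c _ hz𝔪 hd' hJ 𝓗 G h𝓗 hG => vertex_fibre hσ z c hz𝔪 hd' hJ 𝓗 G h𝓗 hG)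
      x hx hd ℓ
  · exact coreRung_cone_sup_pow_of (fun hσ z c _ hz𝔪 hd' hJ 𝓗 G h𝓗 hG => vertex_fibre hσ z c hz𝔪 hd' hJ 𝓗 G h𝓗 hG)
      x hx hd ℓ
  · exact coreRung_powersPlus_cone_of (fun hσ z c _ hz𝔪 hd' hJ 𝓗 G h𝓗 hG => vertex_fibre hσ z c hz𝔪 hd' hJ 𝓗 G h𝓗 hG)
      x hx hd ℓ

end Rung

/-- **The registered core's binder shape on the member `(x₀x₁ + x₂²) + 𝔪^{ℓ+2}`** (hypotheses of `stub_atomDimFourBlowup`;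
characteristic, completeness, residue field and the off-fibre hypothesis unused). [cite: Kollar2007, 3.61] -/
theorem atomDimFourBlowupAt_cone_sup_pow (p : ℕ) (_hp : p.Prime) (S : Type) [CommRing S]
    [IsRegularLocalRing S] [CharP S p] [IsAdicComplete (IsLocalRing.maximalIdeal S) S]
    [PerfectField (IsLocalRing.ResidueField S)] (hS : ringKrullDim S = (4 : ℕ))
    (x : Fin 4 → S) (hx : Ideal.span (Set.range x) = IsLocalRing.maximalIdeal S) (ℓ : ℕ)
    (T : Scheme.{0}) (f : T ⟶ Spec (.of S))
    (hf : IsBlowup f (affineBlowup.idealSheaf (Ideal.span {x 0 * x 1 + x 2 ^ 2} ⊔ IsLocalRing.maximalIdeal S ^ (ℓ + 2))))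
    (_hoff : ∀ t : T, f.base t ≠ IsLocalRing.closedPoint S → IsRegularLocalRing (T.presheaf.stalk t)) :
    ∃ (J : T.IdealSheafData) (T' : Scheme.{0}) (π : T' ⟶ T), J ≠ ⊥ ∧
      (∀ t : T, t ∈ J.support → f.base t = IsLocalRing.closedPoint S) ∧
      IsBlowup π J ∧ Scheme.IsRegular T' :=
  (coneRung_of_ringKrullDim x hx hS ℓ).2.1 T f hf

/-- **The registered core's binder shape on the member `(x₀^{ℓ+2}, …, x₃^{ℓ+2}, x₀x₁ + x₂²)`.** [cite: StacksProject, Tag 080A] -/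
theorem atomDimFourBlowupAt_powersPlus_cone (p : ℕ) (_hp : p.Prime) (S : Type) [CommRing S]
    [IsRegularLocalRing S] [CharP S p] [IsAdicComplete (IsLocalRing.maximalIdeal S) S]
    [PerfectField (IsLocalRing.ResidueField S)] (hS : ringKrullDim S = (4 : ℕ))
    (x : Fin 4 → S) (hx : Ideal.span (Set.range x) = IsLocalRing.maximalIdeal S) (ℓ : ℕ)
    (T : Scheme.{0}) (f : T ⟶ Spec (.of S))
    (hf : IsBlowup f (affineBlowup.idealSheaf
      (Ideal.span (Set.range (fun i : Fin 4 => x i ^ (ℓ + 2)) ∪ {x 0 * x 1 + x 2 ^ 2}))))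
    (_hoff : ∀ t : T, f.base t ≠ IsLocalRing.closedPoint S → IsRegularLocalRing (T.presheaf.stalk t)) :
    ∃ (J : T.IdealSheafData) (T' : Scheme.{0}) (π : T' ⟶ T), J ≠ ⊥ ∧
      (∀ t : T, t ∈ J.support → f.base t = IsLocalRing.closedPoint S) ∧
      IsBlowup π J ∧ Scheme.IsRegular T' :=
  (coneRung_of_ringKrullDim x hx hS ℓ).2.2 T f hf

end ConeDepth

end Summit.ResolutionOfSingularities.ResolutionOfSingularities.Theorems

end
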